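import Literature.Geometry.Riemannian.MetricFlowFDistance
import Literature.Geometry.Riemannian.RicciFlowMetricFlow
import Literature.Geometry.Riemannian.RicciFlowHeatKernelFn
import Literature.Geometry.Riemannian.CanonicalNeighbourhoods
import Literature.Geometry.Lorentzian.VolumePositivity
import HarnessLib

/-!
# The metric flow pair of a compact Ricci flow with a conjugate heat kernel (Bamler 2023, §5.1 and
# §7.1, Lemma 7.4)

R. Bamler, *Compactness theory of the space of super Ricci flows*, Invent. Math. 233 (2023), §5.1
(Definition (metric flow pairs): a metric flow `𝒳` over `I' ⊆ I`, `|I ∖ I'| = 0`, with a conjugate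
heat flow `(μ_t)_{t ∈ I'}` of full support) and §7.1, Lemma (arXiv v1 Lemma 154): "if `𝒳`
corresponds to a super Ricci flow `(M, (g_t)_{t ∈ I})` on a compact manifold and `(μ_t)`
corresponds to a conjugate heat kernel measure `ν_{x₀;s} = K(x₀, t_max; ·, s) dg_s`, then
`(𝒳, (μ_t)) ∈ 𝔽^{*,J}_I(H_n)`". We construct this object — the metric flow pair over
`I = [a, T]` of a Ricci flow of Riemannian metrics on a closed connected manifold, with
`I' = (a, T)`, the metric flow of the flow restricted to `(a, T)` (`ricciFlowMetricFlow`) and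
`μ_s := ν_{x₀,T;s}` the conjugate heat kernel measures based at `(x₀, T)`
(`ricciFlowMetricFlowPair`): `|I ∖ I'| = |{a, T}| = 0`; `(μ_s)` is a conjugate heat flow by the
reproduction formula; `supp μ_s = M` because `dμ_s = K(x₀,T;·,s) dg_s` with `K > 0`
(`heatKernelMeasure_eq_withDensity_heatKernelFn`, `heatKernelFn_pos`) and `g_s`-volume is positive
on nonempty open sets. (The endpoints are removed from `I'`: at `s = T` the measure is `δ_{x₀}`,
not of full support — cf. Remark 5.? (arXiv v1 Remark 110) of the source — and at `s = a` the
tree's heat kernel is not asserted positive.) This is the object about which the 𝔽-compactness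
and structure theories speak; no facts are assumed.

## References

* R. H. Bamler, *Compactness theory of the space of super Ricci flows*, Invent. Math. 233 (2023),
  1121–1277, §5.1 Definition (metric flow pairs); §7.1 Lemma (super Ricci flows lie in
  `𝔽_I^J(H_n, V, b, r)`). [Bamler2023]
-/

noncomputable section

open Set MeasureTheory Filter TopologicalSpace Function
open scoped Manifold ContDiff Topology ENNReal NNReal

namespace Literature.Geometry.Riemannian

open Lorentzian Lorentzian.PseudoRiemannianMetric

universe u

variable {m : ℕ} {H : Type*} [TopologicalSpace H]
  {I : ModelWithCorners ℝ (EuclideanSpace ℝ (Fin m)) H} [I.Boundaryless]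
  {M : Type u} [TopologicalSpace M] [ChartedSpace H M] [IsManifold I ∞ M]
  [T2Space M] [CompactSpace M] [SecondCountableTopology M] [MeasurableSpace M] [BorelSpace M]
  [ConnectedSpace M]
  {h : ℝ → PseudoRiemannianMetric I ∞ (EuclideanSpace ℝ (Fin m)) (TangentSpace I : M → Type _)}
  {cov : ℝ → CovariantDerivative I (EuclideanSpace ℝ (Fin m)) (TangentSpace I : M → Type _)}
  {a T : ℝ}

/-- **The conjugate heat kernel measures of a Ricci flow have full support**: for a Ricci flow of
Riemannian metrics on a closed connected manifold over `[a, T]`, `a < t ≤ T` and `s ∈ (a, t)`,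
`ν_{x,t;s}` is positive on nonempty open sets (`dν = K dg_s` with `K > 0`, and `g_s`-volume is
positive on nonempty open sets). [cite: Bamler2023, §5.1, Definition (metric flow pairs)]
[cite: Bamler2020Entropy, §2.3] -/
theorem isOpenPosMeasure_heatKernelMeasure (hflow : IsRicciFlow h cov (Icc a T))
    (hh : IsContMDiffFamilyOn ∞ h univ) (hR : ∀ r, (h r).IsRiemannian) {t : ℝ}
    (ht : t ∈ Ioc a T) (x : M) {s : ℝ} (hs : s ∈ Ioo a t) :
    (heatKernelMeasure hh hR t x s).IsOpenPosMeasure := by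
  rw [hflow.heatKernelMeasure_eq_withDensity_heatKernelFn hh hR ht x hs]
  -- the Riemannian volume is positive on nonempty open sets
  haveI : (h s).riemVolume.IsOpenPosMeasure := by
    rw [riemVolume_eq (hR s)]
    exact isOpenPosMeasure_riemannianMeasure _
  -- the density is positive and measurable
  have hcont : Continuous fun y : M ↦ hflow.heatKernelFn hh hR t x (y, s) := by
    have hc := hflow.continuousOn_heatKernelFn hh hR ht
    have h1 : Continuous fun y : M ↦ ((x, (y, s)) : M × (M × ℝ)) := by fun_prop
    exact hc.comp_continuous h1 fun y ↦ ⟨mem_univ _, mem_univ _, hs⟩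
  refine (withDensity_absolutelyContinuous' ?_ ?_).isOpenPosMeasure
  · exact (ENNReal.measurable_ofReal.comp hcont.measurable).aemeasurable
  · exact Eventually.of_forall fun y ↦ (ENNReal.ofReal_pos.2
      (hflow.heatKernelFn_pos hh hR ht x ⟨mem_univ _, hs⟩)).ne'

variable (hh : IsContMDiffFamilyOn ∞ h univ) (hR : ∀ r, (h r).IsRiemannian)

/-- **The metric flow pair of a compact Ricci flow with a conjugate heat kernel** (Bamler 2023,
§5.1 with §7.1, Lemma: the pair `(𝒳, (ν_{x₀;s})_s)` of the metric flow of a Ricci flow on a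
compact manifold and the conjugate heat kernel measures based at a point of the final
time-slice): over `I = [a, T]`, with `I' = (a, T)` (`|I ∖ I'| = |{a, T}| = 0`), the metric flow of
the flow restricted to `(a, T)`, and `μ_s := ν_{x₀,T;s}`.
[cite: Bamler2023, §5.1, Definition (metric flow pairs); §7.1, Lemma (super Ricci flows)] -/
def ricciFlowMetricFlowPair (hflow : IsRicciFlow h cov (Icc a T)) (haT : a < T) (x₀ : M) :
    MetricFlowPair.{u} (Icc a T) where
  I' := Ioo a T
  subset := Ioo_subset_Icc_self
  volume_diff := by
    rw [Icc_sdiff_Ioo_same haT.le]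
    exact (toFinite _).measure_zero _
  flow := ricciFlowMetricFlow hh hR Set.ordConnected_Ioo (hflow.mono Ioo_subset_Icc_self)
  μ := fun s ↦ (heatKernelMeasure hh hR T x₀ (s : ℝ) :)
  isConjugateHeatFlow := by
    refine ⟨fun s _ ↦ isProbabilityMeasure_heatKernelMeasure hh hR T x₀ s, ?_⟩
    intro s t _ ht hst S hS
    exact heatKernelMeasure_apply_eq_lintegral hh hR hst ht.2.le x₀ hS
  isOpenPosMeasure := fun s ↦
    isOpenPosMeasure_heatKernelMeasure hflow hh hR ⟨haT, le_rfl⟩ x₀ s.2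

/-- The times at which the pair is defined are `(a, T)`. [cite: Bamler2023, §5.1, Definition (metric flow pairs)] -/
@[simp] theorem ricciFlowMetricFlowPair_I' (hflow : IsRicciFlow h cov (Icc a T)) (haT : a < T)
    (x₀ : M) : (ricciFlowMetricFlowPair hh hR hflow haT x₀).I' = Ioo a T := rfl

/-- The measures of the pair are the conjugate heat kernel measures based at `(x₀, T)`.
[cite: Bamler2023, §5.1, Definition (metric flow pairs)] -/
@[simp] theorem ricciFlowMetricFlowPair_μ (hflow : IsRicciFlow h cov (Icc a T)) (haT : a < T)
    (x₀ : M) (s : Ioo a T) :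
    (ricciFlowMetricFlowPair hh hR hflow haT x₀).μ s = (heatKernelMeasure hh hR T x₀ (s : ℝ) :) :=
  rfl

/-- **The pair is fully defined over every `J ⊆ (a, T)`.**
[cite: Bamler2023, §5.1, Definition (metric flow pairs)] -/
theorem ricciFlowMetricFlowPair_fullyDefinedOver (hflow : IsRicciFlow h cov (Icc a T))
    (haT : a < T) (x₀ : M) {J : Set ℝ} (hJ : J ⊆ Ioo a T) :
    (ricciFlowMetricFlowPair hh hR hflow haT x₀).FullyDefinedOver J := hJ

/-- **The exceptional set of the pair is measurable** (`[a, T] ∖ (a, T) = {a, T}`), the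
hypothesis under which `MetricFlowPair.fDist_self` applies. [cite: Bamler2023, §5.1, Definition (metric flow pairs)] -/
theorem measurableSet_Icc_diff_ricciFlowMetricFlowPair_I' (hflow : IsRicciFlow h cov (Icc a T))
    (haT : a < T) (x₀ : M) :
    MeasurableSet (Icc a T \ (ricciFlowMetricFlowPair hh hR hflow haT x₀).I') := by
  rw [ricciFlowMetricFlowPair_I', Icc_sdiff_Ioo_same haT.le]
  exact (toFinite _).measurableSet

end Literature.Geometry.Riemannian

end
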